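import Summits.Ventures.HSemireg.Pad4TowerLinePhaseRigidityNucleus2

/-!
# Pad4Tower ∕ LinePhaseRigidity — Part K THE PHASE-TYPE LAW IS A THEOREM: `PureFCLine h` for `h < 10`, `AntipodalFCLine h` for `h < 12`, `PhaseTypeLaw` (PROVED outright)
# (HSemireg support file; PT-PORT-2 (a3), tree copy of control's crux workfile)

Crux of record: `Summit.HodgeConjecture.HodgeConjecture.Theses.EightfoldBlochSeeds.BlochSeedDiscOne` (= `HasHyperbolicBlochSeed 4 1`, item
stmt-HodgeConjecture-18881; skeleton `Cruxes/BlochSeedDiscOne/Lines/birth.lean` 814a6a70c14e831a, STUB R `stub_rung_pad4_seedAt`, UNTOUCHED).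
Nothing in this file proves HC, HC_AV, HC_CM, H2, item 18881, (T₈) or (T₁₀); census-neutral (no SAT∕UNSAT row is added or changed). Statements about
the typed FIRST-ORDER static game on the LINE alphabet of the PAD-4 design tower (`RuleDMu4Closed`, `XPlusClosed`, `G1Closed` of record) — H₁-static
letter DESIGNS, not sheaves, monads or seeds; HC_CM is a displayed binder of the ladder only, unused here.

PROVENANCE. TREE COPY — statements AND proofs verbatim; new are only the namespace `Summit.Ventures.HSemireg.Pad4Tower.LinePhaseRigidity`, this module docstring, the module boundary, the
`open` of the tree toolkit namespace `…Pad4Tower.LineInertia` (= the workfile's Part A), one-line docstrings where the gate requires them, and these dedups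
to the tree (the one the key allows: Part J's `fin4_add_two_ne : ∀ k : Fin 4, k + 2 ≠ k` is NOT re-declared — its uses call the toolkit's identical `LineInertia.add_two_ne` —
and, of the same kind, the `decide` fact `fin4_add_one_one : ∀ k : Fin 4, k + 1 + 1 = k + 2` is NOT declared — it duplicates a foreign-summit tree lemma the gate flags
(`CardyFormulaZ2 … CSQuad.f4_11`), so its one use carries the `decide` term inline)
of Part K of the crux workfile `Cruxes/BlochSeedDiscOne/LinePhaseRigidity.lean` v1.9 (author plan-lens-HodgeAV-control g9; crux commit f5c30e1c3066, sha16 f0ad6d2122a71d9c; critic plates idea-crit-6 g15 PASS). Filed in the tree on plan-lens-HodgeAV-control g10's KEY (a3) (bus l.10147: «Parts G–L up to `oddFCFreeLine_of_lt_twelve`,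
`not_oddFCFreeLine_twelve`, `fcShapeLine_of_lt_twelve` → tree, so that `DiamondLevelLaws.OddLineFree h` (∀ h < 12) is a tree theorem and the displayed
hypothesis of `oddThreshold_iff_lineNest` is discharged by name» — control's wording; `DiamondLevelLaws.OddLineFree` ∕ `oddThreshold_iff_lineNest` are declarations of the
crux workfile `Cruxes/BlochSeedDiscOne/DiamondLevelLaws.lean`, NOT of this chain) by hsemireg-phasetorus-typer-1 g3 (v3 docstring∕dedup hygiene by typer-1 g5). Module set of (a3), each importing the previous, on top of
(a2)'s `Pad4TowerLinePhaseRigidityGap`: `Pad4TowerLinePhaseRigidityTags` (Part G) → `…Parity` (Parts H, I) → `…Nucleus1` (Part J, first half) → `…Nucleus2` (Part J, second half: `oddFCFreeLine_of_lt_twelve`, `oddLineThresholdLaw_holds`) → `…PhaseType` (Part K) → `…Shape` (Part L: `fcShapeLine_of_lt_twelve`). 0 sorry, 0 named facts, no instance ∕ notation ∕ set_option ∕ native_decide; docstring on every declaration.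

CONTENT. In `namespace LineModel`: the purity ∕ antipodality nuclei below ten ∕ twelve; top level: **`pureFCLine_of_lt_ten`**, **`antipodalFCLine_of_lt_twelve`**, **`phaseTypeLaw_holds`**.
-/

namespace Summit.Ventures.HSemireg.Pad4Tower.LinePhaseRigidity

open Finset Summit.Ventures.HSemireg.Pad4Tower Summit.Ventures.HSemireg.LinePhaseTorus Summit.Ventures.HSemireg.Pad4Tower.LineInertia

/-! ## Part K — THE PHASE-TYPE LAW IS A THEOREM: `PureFCLine h` for `h < 10`, `AntipodalFCLine h` for `h < 12`, `PhaseTypeLaw`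

The two remaining LRAT-certified finite checks of Part D (`AbstractPureFC 8` = UNSAT of `L8-G1-mixfc`, `AbstractAntipodalFC 10` = UNSAT of
`L10-G1-nap`) fall to the same levers.  Purity below ten is Part I (`fcP_tags_const_below_ten`, no FC `N`-cell below ten).  Antipodality
below twelve: FC `N`-cells have four equal tags (`fcN_tags_const`); an FC `P`-cell with a charge-2 letter has four equal tags
(`fcP_tags_around_two` + `two_units3_absent`); a unit FC `P`-cell with two tags of different parity is of type `000t` (`t` odd), contains an
antipodal pair with a tag outside its class, or is of type `0011` — the first two are Part J, the third is `units_0011_absent` below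
(UP chain of 12 literals at ten: crux-workfile script `upchain.py 10 'P:1_0,1_0,1_1,1_1'`). -/

namespace LineModel

variable {h : ℤ} {vN vP : ACell → Prop}

/-- **THE `0011`-TYPE UNIT CELLS ARE ABSENT below twelve (PROVED)**: `U = P[1_k@a, 1_k@b, 1_{k+1}@c, 1_{k+1}@d]`.  Chain: the hubs
`N1 = U[a ≔ apex]` and `N2 = U[c ≔ apex]` raise (RD-N2; charge 3 would force the two remaining tags `k`, `k+1` to agree, `raise3`) to
`V1 = P[·, 1_k, 2_{k+1}, 1_{k+1}]` and `V2 = P[2_k, 1_k, ·, 1_{k+1}]`; and `V2` with slots `a ↔ c`, `b ↔ d` swapped and tags shifted by `1`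
is `P[·, 1_{k+2}, 2_{k+1}, 1_{k+1}]`, the unit sibling of `V1` at `b` — excluded by `unit_sibling`.  (Type `0033` is the same cell.) -/
theorem units_0011_absent (M : LineModel h vN vP) (hh : h < 12) {U : ACell} (hU : vP U) {a b c d : Fin 4} (hab : a ≠ b)
    (hac : a ≠ c) (had : a ≠ d) (hbc : b ≠ c) (hbd : b ≠ d) (hcd : c ≠ d) (ha1 : (U a).1 = 1) (hb1 : (U b).1 = 1)
    (hc1 : (U c).1 = 1) (hd1 : (U d).1 = 1) (hb2 : (U b).2 = (U a).2) (hc2 : (U c).2 = (U a).2 + 1)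
    (hd2 : (U d).2 = (U a).2 + 1) : False := by
  have hb : U b = (1, (U a).2) := Prod.ext hb1 hb2
  have hc : U c = (1, (U a).2 + 1) := Prod.ext hc1 hc2
  have hd : U d = (1, (U a).2 + 1) := Prod.ext hd1 hd2
  -- the hub `N1 = U[a ≔ apex]`, raised at `c` to exactly `2`
  have hN1 := M.unit_hub hU ha1 0
  have e1a : Function.update U a ((0 : ℕ), (0 : Fin 4)) a = (0, 0) := Function.update_self _ _ _
  have e1b : Function.update U a ((0 : ℕ), (0 : Fin 4)) b = (1, (U a).2) := by rw [Function.update_of_ne hab.symm, hb]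
  have e1c : Function.update U a ((0 : ℕ), (0 : Fin 4)) c = (1, (U a).2 + 1) := by rw [Function.update_of_ne hac.symm, hc]
  have e1d : Function.update U a ((0 : ℕ), (0 : Fin 4)) d = (1, (U a).2 + 1) := by rw [Function.update_of_ne had.symm, hd]
  have h1c1 : (Function.update U a ((0 : ℕ), (0 : Fin 4)) c).1 = 1 := by rw [e1c]
  have h1b1 : (Function.update U a ((0 : ℕ), (0 : Fin 4)) b).1 = 1 := by rw [e1b]
  have h1d1 : (Function.update U a ((0 : ℕ), (0 : Fin 4)) d).1 = 1 := by rw [e1d]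
  have h1a0 : (Function.update U a ((0 : ℕ), (0 : Fin 4)) a).1 = 0 := by rw [e1a]
  obtain ⟨c₁, h1lt, h1le, hV1, h1t⟩ := M.raise3 hh hN1 hbc.symm hcd hac.symm hbd hab.symm had.symm (one_le_of_eq_one h1c1)
    (one_le_of_eq_one h1b1) (one_le_of_eq_one h1d1) h1a0
  rw [h1c1] at h1lt
  have hc₁ : c₁ = 2 := by
    rcases (by omega : c₁ = 2 ∨ c₁ = 3) with e | e
    · exact e
    · exfalso
      have := h1t e
      rw [e1b, e1d] at this
      exact fin4_add_ne_of_ne_zero (U a).2 1 (by decide) this.symm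
  subst hc₁
  rw [show (Function.update U a ((0 : ℕ), (0 : Fin 4)) c).2 = (U a).2 + 1 by rw [e1c]] at hV1
  -- the hub `N2 = U[c ≔ apex]`, raised at `a` to exactly `2`
  have hN2 := M.unit_hub hU hc1 0
  have e2a : Function.update U c ((0 : ℕ), (0 : Fin 4)) a = (1, (U a).2) := by
    rw [Function.update_of_ne hac]; exact Prod.ext ha1 rfl
  have e2b : Function.update U c ((0 : ℕ), (0 : Fin 4)) b = (1, (U a).2) := by rw [Function.update_of_ne hbc, hb]
  have e2c : Function.update U c ((0 : ℕ), (0 : Fin 4)) c = (0, 0) := Function.update_self _ _ _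
  have e2d : Function.update U c ((0 : ℕ), (0 : Fin 4)) d = (1, (U a).2 + 1) := by rw [Function.update_of_ne hcd.symm, hd]
  have h2a1 : (Function.update U c ((0 : ℕ), (0 : Fin 4)) a).1 = 1 := by rw [e2a]
  have h2b1 : (Function.update U c ((0 : ℕ), (0 : Fin 4)) b).1 = 1 := by rw [e2b]
  have h2d1 : (Function.update U c ((0 : ℕ), (0 : Fin 4)) d).1 = 1 := by rw [e2d]
  have h2c0 : (Function.update U c ((0 : ℕ), (0 : Fin 4)) c).1 = 0 := by rw [e2c]
  obtain ⟨c₂, h2lt, h2le, hV2, h2t⟩ := M.raise3 hh hN2 hab had hac hbd hbc hcd.symm (one_le_of_eq_one h2a1)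
    (one_le_of_eq_one h2b1) (one_le_of_eq_one h2d1) h2c0
  rw [h2a1] at h2lt
  have hc₂ : c₂ = 2 := by
    rcases (by omega : c₂ = 2 ∨ c₂ = 3) with e | e
    · exact e
    · exfalso
      have := h2t e
      rw [e2b, e2d] at this
      exact fin4_add_ne_of_ne_zero (U a).2 1 (by decide) this.symm
  subst hc₂
  rw [show (Function.update U c ((0 : ℕ), (0 : Fin 4)) a).2 = (U a).2 by rw [e2a]] at hV2
  -- `V2`, slots `a ↔ c`, `b ↔ d` swapped and shifted by `1`, is the `b`-sibling `(1, k+2)` of `V1`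
  have hS := M.shiftP_by (M.permP _ (M.permP _ hV2 (Equiv.swap a c)) (Equiv.swap b d)) 1
  have hT : vP (Function.update (Function.update (Function.update U a ((0 : ℕ), (0 : Fin 4))) c (2, (U a).2 + 1)) b
      (1, (U a).2 + 2)) := by
    refine M.congrP hS (fun i => ?_)
    dsimp only
    rcases fin4_cover hab hac had hbc hbd hcd i with hi | hi | hi | hi <;> rw [hi]
    · right
      rw [Equiv.swap_apply_of_ne_of_ne hab had, Equiv.swap_apply_left, Function.update_of_ne hac.symm, e2c,
        Function.update_of_ne hab, Function.update_of_ne hac, e1a]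
      exact ⟨rfl, rfl⟩
    · left
      rw [Equiv.swap_apply_left, Equiv.swap_apply_of_ne_of_ne had.symm hcd.symm, Function.update_of_ne had.symm, e2d,
        Function.update_self]
      exact Prod.ext rfl ((by decide : ∀ k : Fin 4, k + 1 + 1 = k + 2) _)
    · left
      rw [Equiv.swap_apply_of_ne_of_ne hbc.symm hcd, Equiv.swap_apply_right, Function.update_self,
        Function.update_of_ne hbc.symm, Function.update_self]
    · left
      rw [Equiv.swap_apply_right, Equiv.swap_apply_of_ne_of_ne hab.symm hbc, Function.update_of_ne hab.symm, e2b,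
        Function.update_of_ne hbd.symm, Function.update_of_ne hcd.symm, e1d]
  refine M.unit_sibling hV1 (s := b) (f := a) hab ?_ ?_ ?_ hT
  · rw [Function.update_of_ne hac, e1a]
  · rw [Function.update_of_ne hbc, e1b]
  · rw [Function.update_of_ne hbc, e1b]; exact add_two_ne _


/-- below twelve an FC `P`-cell with a charge-2 letter at `g0` has four equal tags (PROVED: `fcP_tags_around_two` for the other three; for
the tag at `g0` a second charge-2 letter gives it by the same lemma, else the cell is `P[1_k,1_k,1_k,2_{k'}]` and `two_units3_absent`). -/
theorem fcP_tags_const_of_two (M : LineModel h vN vP) (hh : h < 12) {X : ACell} (hP : vP X) (hc : ∀ f, 1 ≤ (X f).1)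
    {g0 : Fin 4} (hg0 : 2 ≤ (X g0).1) (i : Fin 4) : (X i).2 = (X (g0 + 1)).2 := by
  have hle : ∀ i, (X i).1 ≤ 2 := fun i => M.fcP_charge_le_two hh hP hc i
  obtain ⟨h1, h2, h3, h12, h13, h23⟩ := fin4_others g0
  have hb2 : (X (g0 + 2)).2 = (X (g0 + 1)).2 := M.fcP_tags_around_two hh hP hc hg0 h2.symm h1.symm
  have hc2 : (X (g0 + 3)).2 = (X (g0 + 1)).2 := M.fcP_tags_around_two hh hP hc hg0 h3.symm h1.symm
  have hg0t : (X g0).2 = (X (g0 + 1)).2 := by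
    by_cases e1 : (X (g0 + 1)).1 = 1
    · by_cases e2 : (X (g0 + 2)).1 = 1
      · by_cases e3 : (X (g0 + 3)).1 = 1
        · by_contra hne
          have hd2 : (X g0).1 = 2 := by have := hle g0; omega
          exact M.two_units3_absent hh hP h12 h13 h1 h23 h2 h3 e1 e2 e3 hd2 hb2 hc2 hne
        · have hg3 : 2 ≤ (X (g0 + 3)).1 := by have := hc (g0 + 3); omega
          exact M.fcP_tags_around_two hh hP hc hg3 h3 h13.symm
      · have hg2 : 2 ≤ (X (g0 + 2)).1 := by have := hc (g0 + 2); omega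
        exact M.fcP_tags_around_two hh hP hc hg2 h2 h12.symm
    · have hg1 : 2 ≤ (X (g0 + 1)).1 := by have := hc (g0 + 1); omega
      exact (M.fcP_tags_around_two hh hP hc hg1 h1 h12).trans hb2
  rcases fin4_cover h1.symm h2.symm h3.symm h12 h13 h23 i with hi | hi | hi | hi <;> rw [hi]
  · exact hg0t
  · exact hb2
  · exact hc2

end LineModel

/-- the shape of a unit tag word with two tags of different parity (finite check): a slot `s` such that the other three tags are
equal and `x s` is at odd distance (type `000t`), or two of the other three are antipodal and `x s` lies outside their class, or the
word is of type `0011` ∕ `0033` read from `s`. -/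
theorem nonanti_unit_tags_aux : ∀ x0 x1 x2 x3 : Fin 4,
    (∃ f g : Fin 4, (![x0, x1, x2, x3] f).val % 2 ≠ (![x0, x1, x2, x3] g).val % 2) →
    ∃ s : Fin 4,
      (![x0, x1, x2, x3] (s + 2) = ![x0, x1, x2, x3] (s + 1) ∧ ![x0, x1, x2, x3] (s + 3) = ![x0, x1, x2, x3] (s + 1) ∧
          ![x0, x1, x2, x3] s ≠ ![x0, x1, x2, x3] (s + 1) ∧
          ![x0, x1, x2, x3] s - ![x0, x1, x2, x3] (s + 1) + (![x0, x1, x2, x3] s - ![x0, x1, x2, x3] (s + 1)) ≠ 0) ∨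
      (![x0, x1, x2, x3] (s + 3) = ![x0, x1, x2, x3] (s + 1) + 2 ∧ ![x0, x1, x2, x3] s ≠ ![x0, x1, x2, x3] (s + 1) ∧
          ![x0, x1, x2, x3] s ≠ ![x0, x1, x2, x3] (s + 1) + 2) ∨
      (![x0, x1, x2, x3] (s + 3) = ![x0, x1, x2, x3] (s + 2) + 2 ∧ ![x0, x1, x2, x3] s ≠ ![x0, x1, x2, x3] (s + 2) ∧
          ![x0, x1, x2, x3] s ≠ ![x0, x1, x2, x3] (s + 2) + 2) ∨
      (![x0, x1, x2, x3] (s + 2) = ![x0, x1, x2, x3] (s + 1) + 2 ∧ ![x0, x1, x2, x3] s ≠ ![x0, x1, x2, x3] (s + 1) ∧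
          ![x0, x1, x2, x3] s ≠ ![x0, x1, x2, x3] (s + 1) + 2) ∨
      (![x0, x1, x2, x3] (s + 1) = ![x0, x1, x2, x3] s ∧ ![x0, x1, x2, x3] (s + 2) = ![x0, x1, x2, x3] s + 1 ∧
          ![x0, x1, x2, x3] (s + 3) = ![x0, x1, x2, x3] s + 1) ∨
      (![x0, x1, x2, x3] (s + 2) = ![x0, x1, x2, x3] s ∧ ![x0, x1, x2, x3] (s + 1) = ![x0, x1, x2, x3] s + 1 ∧
          ![x0, x1, x2, x3] (s + 3) = ![x0, x1, x2, x3] s + 1) ∨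
      (![x0, x1, x2, x3] (s + 3) = ![x0, x1, x2, x3] s ∧ ![x0, x1, x2, x3] (s + 1) = ![x0, x1, x2, x3] s + 1 ∧
          ![x0, x1, x2, x3] (s + 2) = ![x0, x1, x2, x3] s + 1) := by
  decide

/-- `nonanti_unit_tags` (Part K; tree copy, statement verbatim). -/
theorem nonanti_unit_tags (x : Fin 4 → Fin 4) (hx : ∃ f g : Fin 4, (x f).val % 2 ≠ (x g).val % 2) :
    ∃ s : Fin 4,
      (x (s + 2) = x (s + 1) ∧ x (s + 3) = x (s + 1) ∧ x s ≠ x (s + 1) ∧ x s - x (s + 1) + (x s - x (s + 1)) ≠ 0) ∨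
      (x (s + 3) = x (s + 1) + 2 ∧ x s ≠ x (s + 1) ∧ x s ≠ x (s + 1) + 2) ∨
      (x (s + 3) = x (s + 2) + 2 ∧ x s ≠ x (s + 2) ∧ x s ≠ x (s + 2) + 2) ∨
      (x (s + 2) = x (s + 1) + 2 ∧ x s ≠ x (s + 1) ∧ x s ≠ x (s + 1) + 2) ∨
      (x (s + 1) = x s ∧ x (s + 2) = x s + 1 ∧ x (s + 3) = x s + 1) ∨
      (x (s + 2) = x s ∧ x (s + 1) = x s + 1 ∧ x (s + 3) = x s + 1) ∨
      (x (s + 3) = x s ∧ x (s + 1) = x s + 1 ∧ x (s + 2) = x s + 1) := by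
  have e : ![x 0, x 1, x 2, x 3] = x := by funext i; fin_cases i <;> rfl
  have := nonanti_unit_tags_aux (x 0) (x 1) (x 2) (x 3) (by rw [e]; exact hx)
  rw [e] at this
  exact this

/-- **`(APP_h)` FOR EVERY `h < 10` (PROVED)**: below ten no abstract model makes a non-pure FC cell present — FC `N`-cells need
`2(c+4) ≤ h` (`fcN_gap_four`), FC `P`-cells have four equal tags (`fcP_tags_const_below_ten`).  Formerly MACHINE (`L8-G1-mixfc` LRAT). -/
theorem abstractPureFC_of_lt_ten {h : ℤ} (hh : h < 10) : AbstractPureFC h := by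
  intro vN vP M X hX
  obtain ⟨hc, f, g, hfg⟩ := hX
  refine ⟨fun hN => ?_, fun hP => hfg (M.fcP_tags_const_below_ten hh hP hc f g)⟩
  have h8 := M.fcN_gap_four hN hc f
  have h1 := hc f
  omega

/-- **`(AAP_h)` FOR EVERY `h < 12` (PROVED)**: below twelve no abstract model makes a non-antipodal FC cell present.  FC `N`-cells have
four equal tags (`fcN_tags_const`); an FC `P`-cell with a charge-2 letter has four equal tags (`fcP_tags_around_two`, and
`two_units3_absent` for the tag of the charge-2 letter itself); a unit FC `P`-cell with two tags of different parity is refuted by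
`units4_odd_absent` ∕ `unitP_antipodal_absent` ∕ `units_0011_absent` according to `nonanti_unit_tags`.  Formerly MACHINE (`L10-G1-nap`). -/
theorem abstractAntipodalFC_of_lt_twelve {h : ℤ} (hh : h < 12) : AbstractAntipodalFC h := by
  intro vN vP M X hX
  obtain ⟨hc, f, g, hfg⟩ := hX
  refine ⟨fun hN => hfg (by rw [M.fcN_tags_const hN hc hh f g]), fun hP => ?_⟩
  by_cases h2 : ∃ g0, 2 ≤ (X g0).1
  · -- a charge-2 letter at `g0`: all four tags coincide (`fcP_tags_const_of_two`, Part L)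
    obtain ⟨g0, hg0⟩ := h2
    exact hfg (by rw [M.fcP_tags_const_of_two hh hP hc hg0 f, M.fcP_tags_const_of_two hh hP hc hg0 g])
  · -- a unit cell
    push Not at h2
    have hunit : ∀ i, (X i).1 = 1 := fun i => by have := hc i; have := h2 i; omega
    obtain ⟨s, hs⟩ := nonanti_unit_tags (fun i => (X i).2) ⟨f, g, hfg⟩
    obtain ⟨h1, h2, h3, h12, h13, h23⟩ := fin4_others s
    rcases hs with ⟨e2, e3, hne, hodd2⟩ | ⟨e3, hne, hne2⟩ | ⟨e3, hne, hne2⟩ | ⟨e2, hne, hne2⟩ | ⟨e1, e2, e3⟩ |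
        ⟨e2, e1, e3⟩ | ⟨e3, e1, e2⟩
    · exact M.units4_odd_absent hh hP h12 h13 h1 h23 h2 h3 (hunit _) (hunit _) (hunit _) (hunit _) e2 e3 hne hodd2
    · exact M.unitP_antipodal_absent hh hP (a := s + 1) (b := s) (c := s + 3) (d := s + 2) h1 h13 h12 h3.symm h2.symm h23.symm
        (hunit _) (hunit _) (hunit _) (hunit _) e3 hne hne2
    · exact M.unitP_antipodal_absent hh hP (a := s + 2) (b := s) (c := s + 3) (d := s + 1) h2 h23 h12.symm h3.symm h1.symm
        h13.symm (hunit _) (hunit _) (hunit _) (hunit _) e3 hne hne2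
    · exact M.unitP_antipodal_absent hh hP (a := s + 1) (b := s) (c := s + 2) (d := s + 3) h1 h12 h13 h2.symm h3.symm h23
        (hunit _) (hunit _) (hunit _) (hunit _) e2 hne hne2
    · exact M.units_0011_absent hh hP (a := s) (b := s + 1) (c := s + 2) (d := s + 3) h1.symm h2.symm h3.symm h12 h13 h23
        (hunit _) (hunit _) (hunit _) (hunit _) e1 e2 e3
    · exact M.units_0011_absent hh hP (a := s) (b := s + 2) (c := s + 1) (d := s + 3) h2.symm h1.symm h3.symm h12.symm h23 h13
        (hunit _) (hunit _) (hunit _) (hunit _) e2 e1 e3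
    · exact M.units_0011_absent hh hP (a := s) (b := s + 3) (c := s + 1) (d := s + 2) h3.symm h1.symm h2.symm h13.symm h23.symm
        h12 (hunit _) (hunit _) (hunit _) (hunit _) e3 e1 e2

/-- **`(PP_h)` FOR EVERY `h < 10` (PROVED, sorry-free, h-uniform)**: every fully charged cell of a `G₁`-static RULE-D∕`X+` LINE design of
height `< 10` is phase-pure. -/
theorem pureFCLine_of_lt_ten {h : ℤ} (hh : h < 10) : PureFCLine h :=
  pureFCLine_of_abstract (abstractPureFC_of_lt_ten hh)

/-- **`(AP_h)` FOR EVERY `h < 12` (PROVED, sorry-free, h-uniform)**: every fully charged cell of a `G₁`-static RULE-D∕`X+` LINE design of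
height `< 12` is antipodal (its charged phases lie in one class `{k₀, k₀+2}`); sharp (`not_antipodalFCLine_twelve`). -/
theorem antipodalFCLine_of_lt_twelve {h : ℤ} (hh : h < 12) : AntipodalFCLine h :=
  antipodalFCLine_of_abstract (abstractAntipodalFC_of_lt_twelve hh)

/-- **THE PHASE-TYPE LAW IS A THEOREM** (PROVED outright, sorry-free): `PureFCLine 8 ∧ AntipodalFCLine 10`. -/
theorem phaseTypeLaw_holds : PhaseTypeLaw :=
  phaseTypeLaw_of_abstract (abstractPureFC_of_lt_ten (by norm_num)) (abstractAntipodalFC_of_lt_twelve (by norm_num))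

end Summit.Ventures.HSemireg.Pad4Tower.LinePhaseRigidity
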